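import Summits.CriticalPhenomena.CardyFormulaZ2.Theorems.HalfPlaneMarkDensityLaw.Negative.MarkEvents
import Literature.Probability.Percolation.HalfPlaneOneArmQuasiMultiplicativity
import Literature.Probability.Percolation.HalfPlaneArmAxisInputs
import HarnessLib

/-!
# Line `Sketch` — crux 5 ⟹ crux 6, lattice stub: a row-to-row half-plane crossing crosses the
# half-annulus (crux stmt-CriticalPhenomena-5661, lead c10-0/c11-0)

In the axis coordinates `X v = v 0`, `Y v = v 1` of bond-`ℤ²` with base point `0`, write
`ν v = max |v 0 - 0| (v 1 - 0)` for the half-plane sup-norm, `ann₀[r, R] = {0 ≤ v 1 ∧ r ≤ ν v ∧ ν v ≤ R}`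
for the upper half-annulus and `E₀[r, R] = openCrossing ann₀[r, R] {ν = r} {ν = R}` for its block
crossing event.

* `stub_lowerBlock`: for `-r ≤ A`, `B ≤ r ≤ R ≤ C`,
  `P_{1/2}[[A,B]×{0} ↔ [C,D]×{0} in ℤ×ℕ] ≤ P_{1/2}(E₀[r, R])` — on a lattice configuration an open
  path of the half-plane from the bottom-row segment `[A,B]×{0} ⊆ {ν ≤ r}` to `[C,D]×{0} ⊆ {R ≤ ν}`,
  clipped to the window `r ≤ ν ≤ R` of the `1`-Lipschitz norm (`exists_openConnIn_clip`), is an open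
  crossing of `ann₀[r, R]` between its two rims; then monotonicity of the measure (`P_{1/2}` is
  carried by lattice configurations, `ae_subset_edgeSet`).
-/

noncomputable section

namespace Summit.CriticalPhenomena.CardyFormulaZ2.Cruxes.HalfPlaneMarkDensityLaw.SketchLine

open Literature.Probability.Percolation Literature.Probability.LatticeModels
open MeasureTheory Filter Set
open scoped Topology
open Summit.CriticalPhenomena.CardyFormulaZ2.Theorems.HalfPlaneMarkDensityLaw.Negative

namespace OneArm

/-- The half-plane sup-norm `ν v = max |v 0 - 0| (v 1 - 0)` about the base point `0` moves by at most
one along an edge of `ℤ²` (`HalfPlaneArm.norm_le_of_adj` in the axis coordinates). [folklore] -/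
private theorem stub_lowerBlock_aux_lip (u v : Site 2) (h : (zdGraph 2).Adj u v) :
    max |v 0 - (0 : Site 2) 0| (v 1 - (0 : Site 2) 1) ≤
      max |u 0 - (0 : Site 2) 0| (u 1 - (0 : Site 2) 1) + 1 :=
  HalfPlaneArm.norm_le_of_adj (X := fun v : Site 2 => v 0) (Y := fun v : Site 2 => v 1)
    HalfPlaneArm.axis_X_le HalfPlaneArm.axis_Y_le 0 u v h

/-- **Deterministic inclusion.** On a lattice configuration `ω ⊆ E(ℤ²)`, an open path of the
half-plane `ℤ×ℕ` from the bottom-row segment `[A,B]×{0}` (inside `{ν ≤ r}` as `-r ≤ A`, `B ≤ r`) to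
the segment `[C,D]×{0}` (inside `{R ≤ ν}` as `R ≤ C`) contains, for `r ≤ R`, an open crossing of the
upper half-annulus `ann₀[r, R]` from its inner rim `{ν = r}` to its outer rim `{ν = R}` (clip the path
to the window `r ≤ ν ≤ R` of the `1`-Lipschitz norm `ν`). [folklore] -/
private theorem stub_lowerBlock_aux_mem {ω : BondConfig (Site 2)} (hω : ω ⊆ (zdGraph 2).edgeSet)
    {A B C D r R : ℤ} (hA : -r ≤ A) (hB : B ≤ r) (hrR : r ≤ R) (hRC : R ≤ C)
    (h : ω ∈ openCrossing halfPlane (rowIcc A B) (rowIcc C D)) :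
    ω ∈ openCrossing
      {v : Site 2 | 0 ≤ v 1 ∧ r ≤ max |v 0 - (0 : Site 2) 0| (v 1 - (0 : Site 2) 1) ∧
        max |v 0 - (0 : Site 2) 0| (v 1 - (0 : Site 2) 1) ≤ R}
      {v : Site 2 | max |v 0 - (0 : Site 2) 0| (v 1 - (0 : Site 2) 1) = r}
      {v : Site 2 | max |v 0 - (0 : Site 2) 0| (v 1 - (0 : Site 2) 1) = R} := by
  obtain ⟨x, hx, y, hy, hxy⟩ := h
  simp only [rowIcc, mem_setOf_eq] at hx hy
  obtain ⟨hx1, hxA, hxB⟩ := hx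
  obtain ⟨hy1, hyC, -⟩ := hy
  have hxν : max |x 0 - (0 : Site 2) 0| (x 1 - (0 : Site 2) 1) ≤ r := by
    simp only [Pi.zero_apply, sub_zero]
    exact max_le (abs_le.2 ⟨by omega, by omega⟩) (by omega)
  have hyν : R ≤ max |y 0 - (0 : Site 2) 0| (y 1 - (0 : Site 2) 1) := by
    simp only [Pi.zero_apply, sub_zero]
    exact le_max_of_le_left ((show R ≤ y 0 by omega).trans (le_abs_self _))
  obtain ⟨x', y', hx', hy', hconn⟩ := exists_openConnIn_clip hω
    (fun v : Site 2 => max |v 0 - (0 : Site 2) 0| (v 1 - (0 : Site 2) 1)) stub_lowerBlock_aux_lip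
    hrR hxν hyν hxy
  refine ⟨x', hx', y', hy', openConnIn_mono (fun v hv => ?_) _ _ hconn⟩
  exact ⟨hv.1, hv.2.1, hv.2.2⟩

/-- STUB (lattice) `stub_lowerBlock`: the half-annulus block crossing probability is bounded BELOW by
a Cardy-type row-to-row crossing probability: for `-r ≤ A`, `B ≤ r ≤ R ≤ C`,
`P_{1/2}[[A,B]×{0} ↔ [C,D]×{0} in ℤ×ℕ] ≤ P_{1/2}(E₀[r, R])`
(deterministic inclusion `stub_lowerBlock_aux_mem` on lattice configurations, which carry `P_{1/2}`,
and monotonicity of the measure). [folklore] -/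
theorem stub_lowerBlock : ∀ A B C D r R : ℤ, -r ≤ A → B ≤ r → r ≤ R → R ≤ C → μ.real (openCrossing halfPlane (rowIcc A B) (rowIcc C D)) ≤ μ.real (openCrossing {v : Site 2 | 0 ≤ v 1 ∧ r ≤ max |v 0 - (0 : Site 2) 0| (v 1 - (0 : Site 2) 1) ∧ max |v 0 - (0 : Site 2) 0| (v 1 - (0 : Site 2) 1) ≤ R} {v : Site 2 | max |v 0 - (0 : Site 2) 0| (v 1 - (0 : Site 2) 1) = r} {v : Site 2 | max |v 0 - (0 : Site 2) 0| (v 1 - (0 : Site 2) 1) = R}) := by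
  intro A B C D r R hA hB hrR hRC
  refine ENNReal.toReal_mono (measure_ne_top _ _) (measure_mono_ae ?_)
  filter_upwards [ae_subset_edgeSet (zdGraph 2) half] with ω hω h
  exact stub_lowerBlock_aux_mem hω hA hB hrR hRC h

end OneArm

end Summit.CriticalPhenomena.CardyFormulaZ2.Cruxes.HalfPlaneMarkDensityLaw.SketchLine

end
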